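import Literature.NumberTheory.Automorphic.UnitaryGroupTruncatedKernelClassCellBound
import Literature.NumberTheory.Automorphic.UnitaryGroupTruncatedKernelClassIntegrableOfCusp
import Literature.NumberTheory.Automorphic.UnitaryGroupTruncatedKernelIntegrableOfRows
import HarnessLib

/-!
# Per-class integrability of Arthur's truncated kernel `k^T_𝔬` on `U(J₃)` from the rows: the Siegel
# majorant `Φ = (C₀ δ_B / ν(𝓕₀)) · 3Lρ` bounds EVERY `‖K_𝔬 − K_{B,𝔬}‖`

(Arthur, *A trace formula for reductive groups I*, Duke Math. J. 45 (1978), Thm. 7.1 and §8 — the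
integrability of `k^T_𝔬` is proved class by class; Rogawski, *Automorphic Representations of Unitary Groups
in Three Variables* (1990), §2.2 p. 13: «Furthermore, `k^T_𝔬` is integrable over `𝐙G\𝐆`».)

Topic `NumberTheory/Automorphic`; namespace `Literature.NumberTheory.Automorphic.UnitaryGroup`. THEOREMS ONLY
(no definition, no named fact, no instance, no notation, no `sorry`). Row C6 (the trunk's assembly) of the
T1-qs LAW 3 road (`𝔬`-expansion) of `Cruxes/H413/Lines/F0_T1InnerFormTraceIdentity.lean` (cell
`pub/hodgecm-mathlib`, crux H413) — the CLASS REPLAY of ★ `UnitaryGroupTruncatedKernelIntegrableOfRows` over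
the abstract class map `cl : G(F) → ι` of ★ `UnitaryGroupArthurKernelClassExpansion` (`IsConjInvariant`,
`IsUnipotentInvariantOnBorel`):

* INPUTS ★ (per class): the class Siegel property `K_𝔬(g,g) = Σ_{B(F) ∩ 𝔬}` high in the cusp and
  `k^T_𝔬 = K_𝔬 − K_{B,𝔬}` above the cut-off (★ `UnitaryGroupTruncatedKernelClassHighCusp`), the class
  oscillation head `‖k^T_𝔬(g)‖ ≤ #R · 3Lρ` with the SAME `R`, `U`, `L` for every class (★
  `IsQuasiSplitTest.exists_level_norm_truncatedKernelClass_le`, `UnitaryGroupTruncatedKernelClassCellBound`),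
  the per-class reduction of integrability to a cusp estimate (★
  `integrable_quotFun_truncatedKernelClass_of_cusp_estimate`, `UnitaryGroupTruncatedKernelClassIntegrableOfCusp`);
  INPUTS ★ (class-agnostic): the cell count ★ `exists_forall_card_mul_measure_le_mul_torusRootModulus`, the
  Iwasawa heart ★ `setLIntegral_mul_subgroup_le_of_majorant`, `K_U` compact and height preserving.
* HYPOTHESIS: the ROW PACKAGE `hrows` of ★ `truncatedKernelIntegrable_of_rows`, token for token (rows H9b,
  H5b, H10 — all ★ at the CM pair through ★ `UnitaryGroupTruncatedKernelIntegrableOfSiegel`).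

WHAT IS PROVED.
* §0 `kernelBorelClass_eq_of_isFundamentalDomain` — `K_{B,𝔬}` does not depend on `(ν, 𝓕)` (the class Borel
  sum is left `N(F)`-invariant in the second variable, ★ `borelSumClass_unipotent_mul`).
* §1 `enorm_kernelClass_sub_kernelBorelClass_le_majorant` — THE POINTWISE MAJORANT, class by class:
  `‖K_𝔬(bk,bk) − K_{B,𝔬}(bk,bk)‖ₑ ≤ C₀ · ν(𝓕₀)⁻¹ · (3L) · δ_B(b) · ρ` — the classless `Φ`.
* §2 `exists_majorant_class_of_rows` — `hest ∧ hΦ` for every class with ONE `Φ`.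
* §3 `exists_cover_setLIntegral_class_lt_top_of_majorant` — the per-class cusp estimate
  `∫⁻_{S·K_U ∩ {T<H}} ‖K_𝔬 − K_{B,𝔬}‖ₑ dν_G < ∞` (class replay of ★ H8b §2).
* §4 **`truncatedKernelClassIntegrable_of_rows`** (generic quadratic `E/F`) and
  **`truncatedKernelClassIntegrable_cm_of_rows`** (CM pair, `hc`, `hc1`, unimodularity, `hBK` discharged):
  for every class `𝔬`, `[g] ↦ k^T_𝔬(g⁻¹)` is integrable on `G(F)\G(𝔸_F)` for all large `T`.

## References
* J. Arthur, *A trace formula for reductive groups I*, Duke Math. J. 45 (1978), Thm. 7.1, §8 (pp. 947–950)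
  [Arthur1978TraceFormulaI].
* J. D. Rogawski, *Automorphic Representations of Unitary Groups in Three Variables*, Ann. of Math. Stud.
  123 (1990), §2.2 (p. 13) [Rogawski1990].
* S. Shokranian, *The Selberg–Arthur Trace Formula*, LNM 1503 (1992), §5.2 [Shokranian1992].
-/

set_option autoImplicit false

noncomputable section

open MeasureTheory Measure NumberField NumberField.mixedEmbedding IsDedekindDomain Set
open scoped NNReal ENNReal Pointwise MatrixGroups Classical

namespace Literature.NumberTheory.Automorphic

namespace UnitaryGroup

variable {F E : Type} [Field F] [NumberField F] [Field E] [NumberField E] [Algebra F E]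
  {c : E ≃ₐ[F] E} {ι : Type*}

section Rows

variable [MeasurableSpace (adelicUnipotent F E c 3)] [BorelSpace (adelicUnipotent F E c 3)]

/-! ## §0 `K_{B,𝔬}` does not depend on the unipotent data `(ν, 𝓕)` -/

/-- **`K_{B,𝔬}^{ν,𝓕} = K_{B,𝔬}^{ν',𝓕'}`**: the class Borel kernel is the Borel constant term of the class Borel sum
`z ↦ Σ_{β ∈ B(F), cl β = 𝔬} f(x⁻¹ β z)`, which is left `N(F)`-invariant (★ `borelSumClass_unipotent_mul`, the
`N(F)`-saturation `hclN` of the classes on `B(F)`), so ★ `borelConstantTerm_eq_of_isHaarMeasure` applies.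
[cite: Rogawski1990, §2.2 (p. 13)] -/
theorem kernelBorelClass_eq_of_isFundamentalDomain (ν ν' : Measure (adelicUnipotent F E c 3))
    [ν.IsHaarMeasure] [ν'.IsHaarMeasure] {𝓕 𝓕' : Set (adelicUnipotent F E c 3)}
    (h𝓕 : IsFundamentalDomain (rationalUnipotent F E c 3) 𝓕 ν)
    (h𝓕' : IsFundamentalDomain (rationalUnipotent F E c 3) 𝓕' ν')
    {cl : (quasiSplit F E c 3).arithmeticSubgroup → ι} (hclN : IsUnipotentInvariantOnBorel F E c 3 cl) (i : ι)
    (f : (quasiSplit F E c 3).Adelic → ℂ) :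
    kernelBorelClass ν 𝓕 cl i f = kernelBorelClass ν' 𝓕' cl i f := by
  funext x y
  rw [kernelBorelClass_def, kernelBorelClass_def,
    borelConstantTerm_eq_of_isHaarMeasure ν ν' h𝓕 h𝓕'
      (fun u hu z => borelSumClass_unipotent_mul hclN i f x z
        ⟨(u : (quasiSplit F E c 3).Adelic), Subgroup.mem_comap.1 hu⟩ u.2)]

/-! ## §1 The pointwise majorant, class by class -/

omit [MeasurableSpace (adelicUnipotent F E c 3)] [BorelSpace (adelicUnipotent F E c 3)] in
/-- Coercion plumbing: `insert 1 (↑W₀)` in `G(𝔸)` is the image of `insert 1 W₀ ⊆ N(𝔸)`. [folklore] -/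
private theorem mem_image_insert_one_of_mem_insert₆ {W₀ : Set (adelicUnipotent F E c 3)}
    {y : (quasiSplit F E c 3).Adelic}
    (hy : y ∈ insert (1 : (quasiSplit F E c 3).Adelic)
      ((fun u : adelicUnipotent F E c 3 => (u : (quasiSplit F E c 3).Adelic)) '' W₀)) :
    ∃ y' ∈ insert (1 : adelicUnipotent F E c 3) W₀, (y' : (quasiSplit F E c 3).Adelic) = y := by
  rcases hy with rfl | ⟨u, hu, rfl⟩
  · exact ⟨1, Set.mem_insert _ _, rfl⟩
  · exact ⟨u, Set.mem_insert_of_mem _ hu, rfl⟩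

/-- **THE POINTWISE MAJORANT ON THE SIEGEL SET, CLASS BY CLASS.**  In the setting of ★
`enorm_kernel_sub_kernelBorel_le_majorant` with the class oscillation head `hH5` (★
`IsQuasiSplitTest.exists_level_norm_truncatedKernelClass_le`: `‖k^T_𝔬(g)‖ ≤ #R · 3Lρ`, the same `R` for every
class) and the class Siegel property `hc₀` (★ `exists_forall_kernelClass_eq_borelSumClass_of_lt_borelHeight`): for
`b` reduced, `k ∈ K_U`, `max(1, c₀) ≤ T < H(b)` and the three-factor geometry at scale `ρ`,
`‖K_𝔬(bk,bk) − K_{B,𝔬}^{ν,𝓕}(bk,bk)‖ₑ ≤ C₀ · ν(𝓕₀)⁻¹ · (3L) · δ_B(b) · ρ` for EVERY class `𝔬`.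
[cite: Arthur1978TraceFormulaI, Thm. 7.1] [cite: Rogawski1990, §2.2 (p. 13)] -/
theorem enorm_kernelClass_sub_kernelBorelClass_le_majorant (ν : Measure (adelicUnipotent F E c 3)) [ν.IsHaarMeasure]
    {𝓕 𝓕₀ W₀ : Set (adelicUnipotent F E c 3)}
    (h𝓕 : IsFundamentalDomain (rationalUnipotent F E c 3) 𝓕 ν)
    (h𝓕₀ : IsFundamentalDomain (rationalUnipotent F E c 3) 𝓕₀ ν) (hW₀ : IsCompact W₀) (h𝓕₀W₀ : 𝓕₀ ⊆ W₀)
    {cl : (quasiSplit F E c 3).arithmeticSubgroup → ι} (hcl : IsConjInvariant cl)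
    (hclN : IsUnipotentInvariantOnBorel F E c 3 cl) (i : ι)
    {f : (quasiSplit F E c 3).Adelic → ℂ}
    {S_dir : Set (Matrix (Fin 3) (Fin 3) (mixedSpace E))} {U : Subgroup (GL (Fin 3) (AdeleRing (𝓞 E) E))}
    {L : ℝ} (hL : 0 ≤ L)
    (hH5 : ∀ {T : ℝ≥0}, 1 ≤ T → ∀ {g : (quasiSplit F E c 3).Adelic}, T < borelHeight g →
        kernelClass cl i f g g = borelSumClass cl i f g g → ∀ (ρ : ℝ),
        (∀ u ∈ 𝓕₀, ∃ (t₁ t₂ t₃ : ℝ) (X₁ X₂ X₃ : Matrix (Fin 3) (Fin 3) (mixedSpace E))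
            (w : GL (Fin 3) (AdeleRing (𝓞 E) E)),
          X₁ ∈ S_dir ∧ X₂ ∈ S_dir ∧ X₃ ∈ S_dir ∧ w ∈ U ∧ |t₁| ≤ ρ ∧ |t₂| ≤ ρ ∧ |t₃| ≤ ρ ∧
          adelicVal F E c 3 _ (g⁻¹ * (u : (quasiSplit F E c 3).Adelic) * g) =
            GLn.ofInfinite 3 E (expGL (t₁ • X₁) * expGL (t₂ • X₂) * expGL (t₃ • X₃)) * w) →
        ∃ R : Finset (arithmeticBorel F E c 3),
          (∀ β ∈ R, ∃ y ∈ insert (1 : (quasiSplit F E c 3).Adelic)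
              ((fun u : adelicUnipotent F E c 3 => (u : (quasiSplit F E c 3).Adelic)) '' W₀),
            g⁻¹ * (((β : (quasiSplit F E c 3).arithmeticSubgroup)) : (quasiSplit F E c 3).Adelic) *
              (y * g) ∈ tsupport f) ∧
          ‖truncatedKernelClass ν 𝓕₀ T cl i f g‖ ≤ R.card * (3 * L * ρ))
    {Ω : Set (quasiSplit F E c 3).Adelic} {R₁ R₂ : Set (AdeleRing (𝓞 E) E)} {C₀ : ℝ≥0}
    (hH4 : ∀ b : borelAdelic F E c 3,
      (((torusPart b)⁻¹ * b : borelAdelic F E c 3) : (quasiSplit F E c 3).Adelic) ∈ Ω →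
      (((diagUnit b.2 0)⁻¹ * diagUnit b.2 1 : (AdeleRing (𝓞 E) E)ˣ) : AdeleRing (𝓞 E) E) ∈ R₁ →
      (((diagUnit b.2 0)⁻¹ * diagUnit b.2 2 : (AdeleRing (𝓞 E) E)ˣ) : AdeleRing (𝓞 E) E) ∈ R₂ →
      ∀ k ∈ (((standardMaximalCompactGL 3 E).comap (adelicVal F E c 3 ((StdForm.antidiagonal 3).over E)) :
          Subgroup (quasiSplit F E c 3).Adelic) : Set (quasiSplit F E c 3).Adelic),
        ∀ R : Finset (arithmeticBorel F E c 3),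
        (∀ β ∈ R, ∃ y ∈ insert (1 : adelicUnipotent F E c 3) W₀, ((b : (quasiSplit F E c 3).Adelic) * k)⁻¹ *
          (((β : (quasiSplit F E c 3).arithmeticSubgroup)) : (quasiSplit F E c 3).Adelic) *
          ((y : (quasiSplit F E c 3).Adelic) * ((b : (quasiSplit F E c 3).Adelic) * k)) ∈ tsupport f) →
        (R.card : ℝ≥0∞) * ν 𝓕₀ ≤ (C₀ : ℝ≥0∞) * ((torusRootModulus E 3 (diagUnit b.2) : ℝ≥0) : ℝ≥0∞))
    {c₀ : ℝ≥0} (hc₀ : ∀ g : (quasiSplit F E c 3).Adelic, c₀ < borelHeight g →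
      kernelClass cl i f g g = borelSumClass cl i f g g)
    {T : ℝ≥0} (hT1 : 1 ≤ T) (hTc₀ : c₀ ≤ T)
    {b : borelAdelic F E c 3}
    (hbΩ : (((torusPart b)⁻¹ * b : borelAdelic F E c 3) : (quasiSplit F E c 3).Adelic) ∈ Ω)
    (hb₁ : (((diagUnit b.2 0)⁻¹ * diagUnit b.2 1 : (AdeleRing (𝓞 E) E)ˣ) : AdeleRing (𝓞 E) E) ∈ R₁)
    (hb₂ : (((diagUnit b.2 0)⁻¹ * diagUnit b.2 2 : (AdeleRing (𝓞 E) E)ˣ) : AdeleRing (𝓞 E) E) ∈ R₂)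
    {k : (quasiSplit F E c 3).Adelic}
    (hk : adelicVal F E c 3 ((StdForm.antidiagonal 3).over E) k ∈ standardMaximalCompactGL 3 E)
    (hTb : T < borelHeight (b : (quasiSplit F E c 3).Adelic)) {ρ : ℝ}
    (hgeom : ∀ u ∈ 𝓕₀, ∃ (t₁ t₂ t₃ : ℝ) (X₁ X₂ X₃ : Matrix (Fin 3) (Fin 3) (mixedSpace E))
        (w : GL (Fin 3) (AdeleRing (𝓞 E) E)),
      X₁ ∈ S_dir ∧ X₂ ∈ S_dir ∧ X₃ ∈ S_dir ∧ w ∈ U ∧ |t₁| ≤ ρ ∧ |t₂| ≤ ρ ∧ |t₃| ≤ ρ ∧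
      adelicVal F E c 3 _ ((((b : (quasiSplit F E c 3).Adelic) * k)⁻¹ *
          (u : (quasiSplit F E c 3).Adelic) * ((b : (quasiSplit F E c 3).Adelic) * k))) =
        GLn.ofInfinite 3 E (expGL (t₁ • X₁) * expGL (t₂ • X₂) * expGL (t₃ • X₃)) * w) :
    (‖kernelClass cl i f ((b : (quasiSplit F E c 3).Adelic) * k) ((b : (quasiSplit F E c 3).Adelic) * k) -
        kernelBorelClass ν 𝓕 cl i f ((b : (quasiSplit F E c 3).Adelic) * k)
          ((b : (quasiSplit F E c 3).Adelic) * k)‖ₑ : ℝ≥0∞) ≤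
      (C₀ : ℝ≥0∞) * (ν 𝓕₀)⁻¹ * ENNReal.ofReal (3 * L) *
        (((torusRootModulus E 3 (diagUnit b.2) : ℝ≥0) : ℝ≥0∞) * ENNReal.ofReal ρ) := by
  set g : (quasiSplit F E c 3).Adelic := (b : (quasiSplit F E c 3).Adelic) * k with hg
  have hkK : k ∈ (((standardMaximalCompactGL 3 E).comap
      (adelicVal F E c 3 ((StdForm.antidiagonal 3).over E)) : Subgroup (quasiSplit F E c 3).Adelic) :
        Set (quasiSplit F E c 3).Adelic) := Subgroup.mem_comap.2 hk
  have hHg : borelHeight g = borelHeight (b : (quasiSplit F E c 3).Adelic) :=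
    borelHeight_mul_of_mem_comap_standardMaximalCompactGL (Subgroup.mem_comap.2 hk) _
  have hTg : T < borelHeight g := by rw [hHg]; exact hTb
  have hKg : kernelClass cl i f g g = borelSumClass cl i f g g := hc₀ g (lt_of_le_of_lt hTc₀ hTg)
  -- the class oscillation head at `g = b k` with the geometry of row H5b
  obtain ⟨R, hRsupp, hRle⟩ := hH5 hT1 hTg hKg ρ hgeom
  -- the cell count (row H4-d) for this `R`
  have hcount : (R.card : ℝ≥0∞) * ν 𝓕₀ ≤
      (C₀ : ℝ≥0∞) * ((torusRootModulus E 3 (diagUnit b.2) : ℝ≥0) : ℝ≥0∞) := by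
    refine hH4 b hbΩ hb₁ hb₂ k hkK R fun β hβ => ?_
    obtain ⟨y, hy, hyC⟩ := hRsupp β hβ
    obtain ⟨y', hy', rfl⟩ := mem_image_insert_one_of_mem_insert₆ hy
    exact ⟨y', hy', hyC⟩
  -- `ν(𝓕₀) ∈ (0, ∞)`
  have hν0 : ν 𝓕₀ ≠ 0 := measure_ne_zero_of_isFundamentalDomain ν h𝓕₀
  have hνtop : ν 𝓕₀ ≠ ⊤ := (lt_of_le_of_lt (measure_mono h𝓕₀W₀) hW₀.measure_lt_top).ne
  have hcard : (R.card : ℝ≥0∞) ≤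
      (C₀ : ℝ≥0∞) * ((torusRootModulus E 3 (diagUnit b.2) : ℝ≥0) : ℝ≥0∞) * (ν 𝓕₀)⁻¹ := by
    rw [← div_eq_mul_inv]
    exact (ENNReal.le_div_iff_mul_le (Or.inl hν0) (Or.inl hνtop)).2 hcount
  -- `‖K_𝔬 − K_{B,𝔬}^{ν,𝓕}‖(g) = ‖k^T_{𝔬;ν,𝓕₀}(g)‖`
  have hKB : kernelBorelClass ν 𝓕 cl i f g g = kernelBorelClass ν 𝓕₀ cl i f g g := by
    rw [kernelBorelClass_eq_of_isFundamentalDomain ν ν h𝓕 h𝓕₀ hclN i f]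
  have hkT : kernelClass cl i f g g - kernelBorelClass ν 𝓕 cl i f g g = truncatedKernelClass ν 𝓕₀ T cl i f g := by
    rw [hKB, truncatedKernelClass_eq_kernelClass_sub_kernelBorelClass hcl hclN ν h𝓕₀ i f hT1 hTg]
  have hρ3 : 0 ≤ 3 * L := by positivity
  calc (‖kernelClass cl i f g g - kernelBorelClass ν 𝓕 cl i f g g‖ₑ : ℝ≥0∞)
      = ENNReal.ofReal ‖truncatedKernelClass ν 𝓕₀ T cl i f g‖ := by rw [hkT, ofReal_norm]
    _ ≤ ENNReal.ofReal ((R.card : ℝ) * (3 * L * ρ)) := ENNReal.ofReal_le_ofReal hRle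
    _ ≤ (R.card : ℝ≥0∞) * ENNReal.ofReal (3 * L * ρ) := by
        by_cases hρ0 : 0 ≤ 3 * L * ρ
        · rw [ENNReal.ofReal_mul (Nat.cast_nonneg _), ENNReal.ofReal_natCast]
        · rw [ENNReal.ofReal_of_nonpos
            (mul_nonpos_iff.2 (Or.inl ⟨Nat.cast_nonneg _, (not_le.1 hρ0).le⟩))]
          exact bot_le
    _ ≤ (C₀ : ℝ≥0∞) * ((torusRootModulus E 3 (diagUnit b.2) : ℝ≥0) : ℝ≥0∞) * (ν 𝓕₀)⁻¹ *
          ENNReal.ofReal (3 * L * ρ) := mul_le_mul' hcard le_rfl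
    _ ≤ (C₀ : ℝ≥0∞) * ((torusRootModulus E 3 (diagUnit b.2) : ℝ≥0) : ℝ≥0∞) * (ν 𝓕₀)⁻¹ *
          (ENNReal.ofReal (3 * L) * ENNReal.ofReal ρ) := by
        gcongr
        by_cases hρ : 0 ≤ ρ
        · rw [ENNReal.ofReal_mul hρ3]
        · rw [ENNReal.ofReal_of_nonpos (mul_nonpos_iff.2 (Or.inl ⟨hρ3, (not_le.1 hρ).le⟩))]
          exact bot_le
    _ = (C₀ : ℝ≥0∞) * (ν 𝓕₀)⁻¹ * ENNReal.ofReal (3 * L) *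
          (((torusRootModulus E 3 (diagUnit b.2) : ℝ≥0) : ℝ≥0∞) * ENNReal.ofReal ρ) := by ring

/-! ## §2 One majorant `Φ` for every class -/

/-- **`hest ∧ hΦ` FOR EVERY CLASS FROM THE ROWS.**  With the data of §1 on a Siegel set `S ⊆ B(𝔸)` REDUCED above
height `T₀` (row H9b), the geometry of row H5b at scale `ρ(b)` and the integrability of row H10, the classless
function `Φ := C₀ · ν(𝓕₀)⁻¹ · (3L) · δ_B · ρ` majorises `‖K_𝔬(bk,bk) − K_{B,𝔬}(bk,bk)‖` for the class `𝔬` and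
has `∫⁻_{S ∩ {H > T}} Φ dμ_B < ∞`, for every `T > max(1, c₀, T₀)`. [cite: Arthur1978TraceFormulaI, Thm. 7.1]
[cite: Rogawski1990, §2.2 (p. 13)] -/
theorem exists_majorant_class_of_rows (ν : Measure (adelicUnipotent F E c 3)) [ν.IsHaarMeasure]
    {𝓕 𝓕₀ W₀ : Set (adelicUnipotent F E c 3)}
    (h𝓕 : IsFundamentalDomain (rationalUnipotent F E c 3) 𝓕 ν)
    (h𝓕₀ : IsFundamentalDomain (rationalUnipotent F E c 3) 𝓕₀ ν) (hW₀ : IsCompact W₀) (h𝓕₀W₀ : 𝓕₀ ⊆ W₀)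
    [MeasurableSpace (quasiSplit F E c 3).Adelic] [BorelSpace (quasiSplit F E c 3).Adelic]
    (μB : Measure (borelAdelic F E c 3)) [μB.IsHaarMeasure]
    {cl : (quasiSplit F E c 3).arithmeticSubgroup → ι} (hcl : IsConjInvariant cl)
    (hclN : IsUnipotentInvariantOnBorel F E c 3 cl) (i : ι)
    {f : (quasiSplit F E c 3).Adelic → ℂ}
    {S_dir : Set (Matrix (Fin 3) (Fin 3) (mixedSpace E))} {U : Subgroup (GL (Fin 3) (AdeleRing (𝓞 E) E))}
    {L : ℝ} (hL : 0 ≤ L)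
    (hH5 : ∀ {T : ℝ≥0}, 1 ≤ T → ∀ {g : (quasiSplit F E c 3).Adelic}, T < borelHeight g →
        kernelClass cl i f g g = borelSumClass cl i f g g → ∀ (ρ : ℝ),
        (∀ u ∈ 𝓕₀, ∃ (t₁ t₂ t₃ : ℝ) (X₁ X₂ X₃ : Matrix (Fin 3) (Fin 3) (mixedSpace E))
            (w : GL (Fin 3) (AdeleRing (𝓞 E) E)),
          X₁ ∈ S_dir ∧ X₂ ∈ S_dir ∧ X₃ ∈ S_dir ∧ w ∈ U ∧ |t₁| ≤ ρ ∧ |t₂| ≤ ρ ∧ |t₃| ≤ ρ ∧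
          adelicVal F E c 3 _ (g⁻¹ * (u : (quasiSplit F E c 3).Adelic) * g) =
            GLn.ofInfinite 3 E (expGL (t₁ • X₁) * expGL (t₂ • X₂) * expGL (t₃ • X₃)) * w) →
        ∃ R : Finset (arithmeticBorel F E c 3),
          (∀ β ∈ R, ∃ y ∈ insert (1 : (quasiSplit F E c 3).Adelic)
              ((fun u : adelicUnipotent F E c 3 => (u : (quasiSplit F E c 3).Adelic)) '' W₀),
            g⁻¹ * (((β : (quasiSplit F E c 3).arithmeticSubgroup)) : (quasiSplit F E c 3).Adelic) *
              (y * g) ∈ tsupport f) ∧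
          ‖truncatedKernelClass ν 𝓕₀ T cl i f g‖ ≤ R.card * (3 * L * ρ))
    {Ω : Set (quasiSplit F E c 3).Adelic} {R₁ R₂ : Set (AdeleRing (𝓞 E) E)} {C₀ : ℝ≥0}
    (hH4 : ∀ b : borelAdelic F E c 3,
      (((torusPart b)⁻¹ * b : borelAdelic F E c 3) : (quasiSplit F E c 3).Adelic) ∈ Ω →
      (((diagUnit b.2 0)⁻¹ * diagUnit b.2 1 : (AdeleRing (𝓞 E) E)ˣ) : AdeleRing (𝓞 E) E) ∈ R₁ →
      (((diagUnit b.2 0)⁻¹ * diagUnit b.2 2 : (AdeleRing (𝓞 E) E)ˣ) : AdeleRing (𝓞 E) E) ∈ R₂ →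
      ∀ k ∈ (((standardMaximalCompactGL 3 E).comap (adelicVal F E c 3 ((StdForm.antidiagonal 3).over E)) :
          Subgroup (quasiSplit F E c 3).Adelic) : Set (quasiSplit F E c 3).Adelic),
        ∀ R : Finset (arithmeticBorel F E c 3),
        (∀ β ∈ R, ∃ y ∈ insert (1 : adelicUnipotent F E c 3) W₀, ((b : (quasiSplit F E c 3).Adelic) * k)⁻¹ *
          (((β : (quasiSplit F E c 3).arithmeticSubgroup)) : (quasiSplit F E c 3).Adelic) *
          ((y : (quasiSplit F E c 3).Adelic) * ((b : (quasiSplit F E c 3).Adelic) * k)) ∈ tsupport f) →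
        (R.card : ℝ≥0∞) * ν 𝓕₀ ≤ (C₀ : ℝ≥0∞) * ((torusRootModulus E 3 (diagUnit b.2) : ℝ≥0) : ℝ≥0∞))
    {c₀ : ℝ≥0} (hc₀ : ∀ g : (quasiSplit F E c 3).Adelic, c₀ < borelHeight g →
      kernelClass cl i f g g = borelSumClass cl i f g g)
    {S : Set (borelAdelic F E c 3)} {T₀ : ℝ≥0}
    (hSred : ∀ b ∈ S, T₀ < borelHeight (b : (quasiSplit F E c 3).Adelic) →
      (((torusPart b)⁻¹ * b : borelAdelic F E c 3) : (quasiSplit F E c 3).Adelic) ∈ Ω ∧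
      (((diagUnit b.2 0)⁻¹ * diagUnit b.2 1 : (AdeleRing (𝓞 E) E)ˣ) : AdeleRing (𝓞 E) E) ∈ R₁ ∧
      (((diagUnit b.2 0)⁻¹ * diagUnit b.2 2 : (AdeleRing (𝓞 E) E)ˣ) : AdeleRing (𝓞 E) E) ∈ R₂)
    {ρ : borelAdelic F E c 3 → ℝ}
    (hgeom : ∀ b ∈ S, T₀ < borelHeight (b : (quasiSplit F E c 3).Adelic) →
      ∀ k : (quasiSplit F E c 3).Adelic,
      adelicVal F E c 3 ((StdForm.antidiagonal 3).over E) k ∈ standardMaximalCompactGL 3 E →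
      ∀ u ∈ 𝓕₀, ∃ (t₁ t₂ t₃ : ℝ) (X₁ X₂ X₃ : Matrix (Fin 3) (Fin 3) (mixedSpace E))
        (w : GL (Fin 3) (AdeleRing (𝓞 E) E)),
      X₁ ∈ S_dir ∧ X₂ ∈ S_dir ∧ X₃ ∈ S_dir ∧ w ∈ U ∧ |t₁| ≤ ρ b ∧ |t₂| ≤ ρ b ∧ |t₃| ≤ ρ b ∧
      adelicVal F E c 3 _ ((((b : (quasiSplit F E c 3).Adelic) * k)⁻¹ *
          (u : (quasiSplit F E c 3).Adelic) * ((b : (quasiSplit F E c 3).Adelic) * k))) =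
        GLn.ofInfinite 3 E (expGL (t₁ • X₁) * expGL (t₂ • X₂) * expGL (t₃ • X₃)) * w)
    (hH10 : ∀ T : ℝ≥0, T₀ < T →
      ∫⁻ b in S ∩ {b | T < borelHeight (b : (quasiSplit F E c 3).Adelic)},
        ((torusRootModulus E 3 (diagUnit b.2) : ℝ≥0) : ℝ≥0∞) * ENNReal.ofReal (ρ b) ∂μB < ∞)
    {T : ℝ≥0} (hT : max (max 1 c₀) T₀ < T) :
    ∃ Φ : borelAdelic F E c 3 → ℝ≥0∞,
      (∀ b ∈ S, ∀ k : (quasiSplit F E c 3).Adelic,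
        adelicVal F E c 3 ((StdForm.antidiagonal 3).over E) k ∈ standardMaximalCompactGL 3 E →
        T < borelHeight (b : (quasiSplit F E c 3).Adelic) →
        (‖kernelClass cl i f ((b : (quasiSplit F E c 3).Adelic) * k) ((b : (quasiSplit F E c 3).Adelic) * k) -
            kernelBorelClass ν 𝓕 cl i f ((b : (quasiSplit F E c 3).Adelic) * k)
              ((b : (quasiSplit F E c 3).Adelic) * k)‖ₑ : ℝ≥0∞) ≤ Φ b) ∧
      ∫⁻ b in S ∩ {b | T < borelHeight (b : (quasiSplit F E c 3).Adelic)}, Φ b ∂μB < ∞ := by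
  have hT1 : 1 ≤ T := ((le_max_left _ _).trans (le_max_left _ _)).trans hT.le
  have hTc₀ : c₀ ≤ T := ((le_max_right _ _).trans (le_max_left _ _)).trans hT.le
  have hT₀ : T₀ < T := lt_of_le_of_lt (le_max_right _ _) hT
  refine ⟨fun b => (C₀ : ℝ≥0∞) * (ν 𝓕₀)⁻¹ * ENNReal.ofReal (3 * L) *
      (((torusRootModulus E 3 (diagUnit b.2) : ℝ≥0) : ℝ≥0∞) * ENNReal.ofReal (ρ b)),
    fun b hb k hk hTb => ?_, ?_⟩
  · have hred := hSred b hb (lt_trans hT₀ hTb)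
    exact enorm_kernelClass_sub_kernelBorelClass_le_majorant ν h𝓕 h𝓕₀ hW₀ h𝓕₀W₀ hcl hclN i hL hH5 hH4 hc₀
      hT1 hTc₀ hred.1 hred.2.1 hred.2.2 hk hTb (hgeom b hb (lt_trans hT₀ hTb) k hk)
  · have hν0 : ν 𝓕₀ ≠ 0 := measure_ne_zero_of_isFundamentalDomain ν h𝓕₀
    have hK : (C₀ : ℝ≥0∞) * (ν 𝓕₀)⁻¹ * ENNReal.ofReal (3 * L) ≠ ⊤ :=
      ENNReal.mul_ne_top (ENNReal.mul_ne_top ENNReal.coe_ne_top (ENNReal.inv_ne_top.2 hν0))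
        ENNReal.ofReal_ne_top
    rw [lintegral_const_mul' _ _ hK]
    exact ENNReal.mul_lt_top hK.lt_top (hH10 T hT₀)

/-! ## §3 The per-class cusp estimate over the Siegel set · `K_U` (class replay of ★ H8b §2) -/

/-- **THE PER-CLASS CUSP ESTIMATE.**  For the compact height-preserving `K_U := adelicVal⁻¹(K_∞ · GL₃(𝒪̂_E))`
with `G(𝔸) = B(𝔸) · K_U`, a closed right-`B(𝔸) ∩ K_U`-saturated Siegel set `S` with `B(F) · S · K_U = G(𝔸)`
and a majorant `Φ` of `‖K_𝔬(bk,bk) − K_{B,𝔬}(bk,bk)‖` on `S · K_U ∩ {H > T}` with finite `μ_B`-integral over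
`S ∩ {H > T}`: the measurable set `D := S · K_U` meets every `B(F)`-orbit and
`∫⁻_{D ∩ {T < H}} ‖K_𝔬(g,g) − K_{B,𝔬}(g,g)‖ₑ dν_G < ∞` — literally the hypothesis `hcusp` of ★
`integrable_quotFun_truncatedKernelClass_of_cusp_estimate` at `(ν_G, ν, 𝓕, f, T)` for the class `𝔬` (★ heart
`setLIntegral_mul_subgroup_le_of_majorant`, class diagonals measurable by ★ `measurable_kernelClass_diag`, ★
`measurable_kernelBorelClass_diag`). [cite: Arthur1978TraceFormulaI, §8 (pp. 947–950)]
[cite: Rogawski1990, §2.2 (p. 13)] -/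
theorem exists_cover_setLIntegral_class_lt_top_of_majorant
    [MeasurableSpace (quasiSplit F E c 3).Adelic] [BorelSpace (quasiSplit F E c 3).Adelic]
    (νG : Measure (quasiSplit F E c 3).Adelic) [νG.IsHaarMeasure]
    (ν : Measure (adelicUnipotent F E c 3)) [ν.IsHaarMeasure] (𝓕 : Set (adelicUnipotent F E c 3))
    (hBK : ∀ g : (quasiSplit F E c 3).Adelic, ∃ b ∈ borelAdelic F E c 3, ∃ k : (quasiSplit F E c 3).Adelic,
      adelicVal F E c 3 ((StdForm.antidiagonal 3).over E) k ∈ standardMaximalCompactGL 3 E ∧ g = b * k)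
    (μB : Measure (borelAdelic F E c 3)) [μB.IsHaarMeasure]
    {S : Set (borelAdelic F E c 3)} (hSc : IsClosed S)
    (hSK : ∀ b ∈ S, ∀ k : borelAdelic F E c 3,
      adelicVal F E c 3 ((StdForm.antidiagonal 3).over E) (k : (quasiSplit F E c 3).Adelic) ∈
        standardMaximalCompactGL 3 E → b * k ∈ S)
    (hcov : ∀ g : (quasiSplit F E c 3).Adelic, ∃ β : (quasiSplit F E c 3).arithmeticSubgroup,
      β ∈ arithmeticBorel F E c 3 ∧ ∃ b ∈ S, ∃ k : (quasiSplit F E c 3).Adelic,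
        adelicVal F E c 3 ((StdForm.antidiagonal 3).over E) k ∈ standardMaximalCompactGL 3 E ∧
        (β : (quasiSplit F E c 3).Adelic) * g = (b : (quasiSplit F E c 3).Adelic) * k)
    (cl : (quasiSplit F E c 3).arithmeticSubgroup → ι) (i : ι)
    {f : (quasiSplit F E c 3).Adelic → ℂ} (hfc : Continuous f) {T : ℝ≥0}
    {Φ : borelAdelic F E c 3 → ℝ≥0∞}
    (hest : ∀ b ∈ S, ∀ k : (quasiSplit F E c 3).Adelic,
      adelicVal F E c 3 ((StdForm.antidiagonal 3).over E) k ∈ standardMaximalCompactGL 3 E →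
      T < borelHeight (b : (quasiSplit F E c 3).Adelic) →
      (‖kernelClass cl i f ((b : (quasiSplit F E c 3).Adelic) * k) ((b : (quasiSplit F E c 3).Adelic) * k) -
          kernelBorelClass ν 𝓕 cl i f ((b : (quasiSplit F E c 3).Adelic) * k)
            ((b : (quasiSplit F E c 3).Adelic) * k)‖ₑ : ℝ≥0∞) ≤ Φ b)
    (hΦ : ∫⁻ b in S ∩ {b | T < borelHeight (b : (quasiSplit F E c 3).Adelic)}, Φ b ∂μB < ∞) :
    ∃ D : Set (quasiSplit F E c 3).Adelic, MeasurableSet D ∧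
      (∀ g : (quasiSplit F E c 3).Adelic, ∃ β : (quasiSplit F E c 3).arithmeticSubgroup,
        β ∈ arithmeticBorel F E c 3 ∧ (β : (quasiSplit F E c 3).Adelic) * g ∈ D) ∧
      ∫⁻ g in D ∩ {g | T < borelHeight g},
        ‖kernelClass cl i f g g - kernelBorelClass ν 𝓕 cl i f g g‖ₑ ∂νG < ∞ := by
  haveI := secondCountableTopology_adeleRing E
  haveI := locallyCompactSpace_adeleRing' E
  haveI := t2Space_adeleRing_of_numberField E
  haveI : T2Space (quasiSplit F E c 3).Adelic :=
    inferInstanceAs (T2Space (adelic F E c 3 ((StdForm.antidiagonal 3).over E)))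
  haveI : LocallyCompactSpace (quasiSplit F E c 3).Adelic :=
    inferInstanceAs (LocallyCompactSpace (adelic F E c 3 ((StdForm.antidiagonal 3).over E)))
  set K : Subgroup (quasiSplit F E c 3).Adelic :=
    (standardMaximalCompactGL 3 E).comap (adelicVal F E c 3 ((StdForm.antidiagonal 3).over E)) with hKdef
  have hK : IsCompact (K : Set (quasiSplit F E c 3).Adelic) :=
    isCompact_comap_adelicVal_standardMaximalCompactGL
  haveI : LocallyCompactSpace K := hK.isClosed.isClosedEmbedding_subtypeVal.locallyCompactSpace
  set μK : Measure K := Measure.haar with hμK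
  -- `N(𝔸_F)` is a closed subgroup: second countable, locally compact, so `ν` is s-finite
  haveI : SecondCountableTopology (quasiSplit F E c 3).Adelic :=
    inferInstanceAs (SecondCountableTopology (adelic F E c 3 ((StdForm.antidiagonal 3).over E)))
  have hNcl : IsClosed ((adelicUnipotent F E c 3 : Set (quasiSplit F E c 3).Adelic)) := by
    change IsClosed (⇑(adelicVal F E c 3 ((StdForm.antidiagonal 3).over E)) ⁻¹'
      ((upperUnitriangular (Fin 3) (AdeleRing (𝓞 E) E) : Subgroup (GL (Fin 3) (AdeleRing (𝓞 E) E))) :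
        Set (GL (Fin 3) (AdeleRing (𝓞 E) E))))
    exact (isClosed_upperUnitriangular (R := AdeleRing (𝓞 E) E)).preimage continuous_subtype_val
  haveI : SecondCountableTopology (adelicUnipotent F E c 3) := TopologicalSpace.Subtype.secondCountableTopology _
  haveI : LocallyCompactSpace (adelicUnipotent F E c 3) := hNcl.locallyCompactSpace
  haveI : SFinite ν := inferInstance
  have hψ : Measurable fun g : (quasiSplit F E c 3).Adelic =>
      (‖kernelClass cl i f g g - kernelBorelClass ν 𝓕 cl i f g g‖ₑ : ℝ≥0∞) :=
    ((measurable_kernelClass_diag cl i hfc).sub (measurable_kernelBorelClass_diag hfc ν 𝓕 cl i)).enorm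
  obtain ⟨C, hCtop, hle⟩ :=
    setLIntegral_mul_subgroup_le_of_majorant νG K hK
      (fun g => by obtain ⟨b, hb, k, hk, hg⟩ := hBK g; exact ⟨b, hb, k, Subgroup.mem_comap.2 hk, hg⟩)
      (fun k hk g => borelHeight_mul_of_mem_comap_standardMaximalCompactGL hk g) μB μK hSc
      (fun b hb k hk => hSK b hb k (Subgroup.mem_comap.1 hk)) hψ (T := T) (Φ := Φ)
      (fun b hb k hk hTb => hest b hb k (Subgroup.mem_comap.1 hk) hTb)
  refine ⟨_, measurableSet_image_mul_subgroup hK hSc, fun g => ?_, lt_of_le_of_lt hle ?_⟩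
  · obtain ⟨β, hβ, b, hb, k, hk, he⟩ := hcov g
    refine ⟨β, hβ, ?_⟩
    rw [he]
    exact Set.mul_mem_mul (Set.mem_image_of_mem _ hb) (Subgroup.mem_comap.2 hk)
  · have hKfin : μK Set.univ < ⊤ := (isCompact_iff_isCompact_univ.1 hK).measure_lt_top
    exact ENNReal.mul_lt_top (ENNReal.mul_lt_top hCtop.lt_top hKfin) hΦ

end Rows

/-! ## §4 Per-class integrability from the rows -/

/-- **EVERY `k^T_𝔬` IS INTEGRABLE, FROM THE ROWS** (generic quadratic `E/F` with `c² = 1`, `c ≠ 1`; unimodularity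
and the adelic Iwasawa decomposition `hBK` as hypotheses).  For a conjugation-invariant, `N(F)`-saturated class map
`cl` and the ROW PACKAGE `hrows` of ★ `truncatedKernelIntegrable_of_rows` (verbatim: Siegel set, structure clause,
three-factor geometry at scale `ρ`, the weight `δ_B ρ` integrable high in the cusp): for every Haar measure `ν` of
`N(𝔸)`, fundamental domain `𝓕`, automorphic measure `μ`, test function `f` and class `𝔬` there is `T₀` with
`[g] ↦ k^T_𝔬(g⁻¹)` `μ`-integrable for all `T > T₀`.  The majorant is the classless one (§2); the last step is ★
`integrable_quotFun_truncatedKernelClass_of_cusp_estimate`. [cite: Arthur1978TraceFormulaI, Thm. 7.1]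
[cite: Rogawski1990, §2.2 (p. 13)] -/
theorem truncatedKernelClassIntegrable_of_rows (hc : c * c = 1) (hc1 : c ≠ 1)
    (hunimod : ∀ [MeasurableSpace (quasiSplit F E c 3).Adelic] [BorelSpace (quasiSplit F E c 3).Adelic]
      (νG : Measure (quasiSplit F E c 3).Adelic), νG.IsHaarMeasure → νG.IsMulRightInvariant)
    (hBK : ∀ g : (quasiSplit F E c 3).Adelic, ∃ b ∈ borelAdelic F E c 3, ∃ k : (quasiSplit F E c 3).Adelic,
      adelicVal F E c 3 ((StdForm.antidiagonal 3).over E) k ∈ standardMaximalCompactGL 3 E ∧ g = b * k)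
    {cl : (quasiSplit F E c 3).arithmeticSubgroup → ι} (hcl : IsConjInvariant cl)
    (hclN : IsUnipotentInvariantOnBorel F E c 3 cl)
    {S_dir : Set (Matrix (Fin 3) (Fin 3) (mixedSpace E))} (hSdir : IsCompact S_dir)
    (hrows : ∀ [MeasurableSpace (adelicUnipotent F E c 3)] [BorelSpace (adelicUnipotent F E c 3)]
      [MeasurableSpace (quasiSplit F E c 3).Adelic] [BorelSpace (quasiSplit F E c 3).Adelic]
      (ν : Measure (adelicUnipotent F E c 3)) [ν.IsHaarMeasure],
      ∃ (μB : Measure (borelAdelic F E c 3)) (_ : μB.IsHaarMeasure) (S : Set (borelAdelic F E c 3))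
        (Ω : Set (quasiSplit F E c 3).Adelic) (R₁ R₂ : Set (AdeleRing (𝓞 E) E)) (T₀ : ℝ≥0),
        IsClosed S ∧
        (∀ b ∈ S, ∀ k : borelAdelic F E c 3,
          adelicVal F E c 3 ((StdForm.antidiagonal 3).over E) (k : (quasiSplit F E c 3).Adelic) ∈
            standardMaximalCompactGL 3 E → b * k ∈ S) ∧
        (∀ g : (quasiSplit F E c 3).Adelic, ∃ β : (quasiSplit F E c 3).arithmeticSubgroup,
          β ∈ arithmeticBorel F E c 3 ∧ ∃ b ∈ S, ∃ k : (quasiSplit F E c 3).Adelic,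
            adelicVal F E c 3 ((StdForm.antidiagonal 3).over E) k ∈ standardMaximalCompactGL 3 E ∧
            (β : (quasiSplit F E c 3).Adelic) * g = (b : (quasiSplit F E c 3).Adelic) * k) ∧
        IsCompact Ω ∧ IsCompact R₁ ∧ IsCompact R₂ ∧
        (∀ b ∈ S, T₀ < borelHeight (b : (quasiSplit F E c 3).Adelic) →
          (((torusPart b)⁻¹ * b : borelAdelic F E c 3) : (quasiSplit F E c 3).Adelic) ∈ Ω ∧
          (((diagUnit b.2 0)⁻¹ * diagUnit b.2 1 : (AdeleRing (𝓞 E) E)ˣ) : AdeleRing (𝓞 E) E) ∈ R₁ ∧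
          (((diagUnit b.2 0)⁻¹ * diagUnit b.2 2 : (AdeleRing (𝓞 E) E)ˣ) : AdeleRing (𝓞 E) E) ∈ R₂) ∧
        ∀ U ∈ finiteLevelsGL 3 E, ∃ (𝓕₀ W₀ : Set (adelicUnipotent F E c 3)) (ρ : borelAdelic F E c 3 → ℝ),
          IsFundamentalDomain (rationalUnipotent F E c 3) 𝓕₀ ν ∧ IsCompact W₀ ∧ 𝓕₀ ⊆ W₀ ∧
          (∀ b ∈ S, T₀ < borelHeight (b : (quasiSplit F E c 3).Adelic) →
            ∀ k : (quasiSplit F E c 3).Adelic,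
            adelicVal F E c 3 ((StdForm.antidiagonal 3).over E) k ∈ standardMaximalCompactGL 3 E →
            ∀ u ∈ 𝓕₀, ∃ (t₁ t₂ t₃ : ℝ) (X₁ X₂ X₃ : Matrix (Fin 3) (Fin 3) (mixedSpace E))
              (w : GL (Fin 3) (AdeleRing (𝓞 E) E)),
            X₁ ∈ S_dir ∧ X₂ ∈ S_dir ∧ X₃ ∈ S_dir ∧ w ∈ U ∧ |t₁| ≤ ρ b ∧ |t₂| ≤ ρ b ∧ |t₃| ≤ ρ b ∧
            adelicVal F E c 3 _ ((((b : (quasiSplit F E c 3).Adelic) * k)⁻¹ *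
                (u : (quasiSplit F E c 3).Adelic) * ((b : (quasiSplit F E c 3).Adelic) * k))) =
              GLn.ofInfinite 3 E (expGL (t₁ • X₁) * expGL (t₂ • X₂) * expGL (t₃ • X₃)) * w) ∧
          (∀ T : ℝ≥0, T₀ < T →
            ∫⁻ b in S ∩ {b | T < borelHeight (b : (quasiSplit F E c 3).Adelic)},
              ((torusRootModulus E 3 (diagUnit b.2) : ℝ≥0) : ℝ≥0∞) * ENNReal.ofReal (ρ b) ∂μB < ∞)) :
    ∀ [MeasurableSpace (adelicUnipotent F E c 3)] [BorelSpace (adelicUnipotent F E c 3)]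
      (ν : Measure (adelicUnipotent F E c 3)) [ν.IsHaarMeasure]
      (𝓕 : Set (adelicUnipotent F E c 3)),
      IsFundamentalDomain (rationalUnipotent F E c 3) 𝓕 ν →
        ∀ (μ : Measure (quasiSplit F E c 3).automorphicQuotient)
          [(quasiSplit F E c 3).IsAutomorphicMeasure μ]
          (f : (quasiSplit F E c 3).Adelic → ℂ), IsQuasiSplitTest F E c 3 f →
          ∀ i : ι, ∃ T₀ : ℝ≥0, ∀ T : ℝ≥0, T₀ < T →
            Integrable ((quasiSplit F E c 3).quotFun (truncatedKernelClass ν 𝓕 T cl i f)) μ := by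
  intro mN bN ν hν 𝓕 h𝓕 μ hμ f hf i
  refine integrable_quotFun_truncatedKernelClass_of_cusp_estimate hc hunimod hcl hclN i ?_ ν h𝓕 μ hf
  intro mU bU mG bG νG hνG ν' hν' 𝓕' h𝓕' f' hf'
  obtain ⟨μB, hμB, S, Ω, R₁, R₂, T₀, hSc, hSK, hcov, hΩ, hR₁, hR₂, hSred, hU⟩ := hrows ν'
  have hfs' : HasCompactSupport f' := hf'.hasCompactSupport'
  have hfc' : Continuous f' := hf'.continuous'
  -- the class oscillation head: the level `U` and the Lipschitz constant `L` of `f'` along `S_dir`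
  obtain ⟨U, hUmem, L, hL, hH5⟩ := hf'.exists_level_norm_truncatedKernelClass_le hSdir
  -- rows H5b and H10 at this level
  obtain ⟨𝓕₀, W₀, ρ, h𝓕₀, hW₀, h𝓕₀W₀, hgeom, hH10⟩ := hU U hUmem
  -- row H4-d: the cell count on the reduced set, and the class Siegel constant `c₀`
  obtain ⟨C₀, hH4⟩ := exists_forall_card_mul_measure_le_mul_torusRootModulus hc hc1 ν' h𝓕₀ hW₀ h𝓕₀W₀
    (hW₀.insert 1) (C := tsupport f') hfs'
    (isCompact_comap_adelicVal_standardMaximalCompactGL (F := F) (E := E) (c := c) (N := 3)) hΩ hR₁ hR₂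
  obtain ⟨c₀, hc₀⟩ := exists_forall_kernelClass_eq_borelSumClass_of_lt_borelHeight (c := c) (ι := ι) hfs'
  refine ⟨max (max 1 c₀) T₀, fun T hT => ?_⟩
  obtain ⟨Φ, hest, hΦ⟩ := exists_majorant_class_of_rows ν' h𝓕' h𝓕₀ hW₀ h𝓕₀W₀ μB hcl hclN i hL
    (fun {T'} hT' {g} hg hK ρ' hge => hH5 ν' h𝓕₀ hW₀ h𝓕₀W₀ hT' hg cl hcl hclN i hK ρ' hge) hH4
    (fun g hg => hc₀ cl i g hg) hSred hgeom hH10 hT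
  exact exists_cover_setLIntegral_class_lt_top_of_majorant νG ν' 𝓕' hBK μB hSc hSK hcov cl i hfc' hest hΦ

/-- **EVERY `k^T_𝔬` IS INTEGRABLE, FROM THE ROWS, AT A CM EXTENSION** — `c² = 1`, `c ≠ 1`, unimodularity (★
`forall_isHaarMeasure_isMulRightInvariant_quasiSplit_cm_three`) and the adelic Iwasawa decomposition (★
`exists_mem_borelAdelic_mul_mem_standardMaximalCompactGL_cm_three`) DISCHARGED.
[cite: Arthur1978TraceFormulaI, Thm. 7.1] [cite: Rogawski1990, §2.2 (p. 13)] -/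
theorem truncatedKernelClassIntegrable_cm_of_rows (L : Type) [Field L] [NumberField L] [IsCMField L]
    {cl : (quasiSplit (↥(maximalRealSubfield L)) L (IsCMField.complexConj L) 3).arithmeticSubgroup → ι}
    (hcl : IsConjInvariant cl)
    (hclN : IsUnipotentInvariantOnBorel (↥(maximalRealSubfield L)) L (IsCMField.complexConj L) 3 cl)
    {S_dir : Set (Matrix (Fin 3) (Fin 3) (mixedSpace L))} (hSdir : IsCompact S_dir)
    (hrows : ∀ [MeasurableSpace (adelicUnipotent (↥(maximalRealSubfield L)) L (IsCMField.complexConj L) 3)]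
      [BorelSpace (adelicUnipotent (↥(maximalRealSubfield L)) L (IsCMField.complexConj L) 3)]
      [MeasurableSpace (quasiSplit (↥(maximalRealSubfield L)) L (IsCMField.complexConj L) 3).Adelic]
      [BorelSpace (quasiSplit (↥(maximalRealSubfield L)) L (IsCMField.complexConj L) 3).Adelic]
      (ν : Measure (adelicUnipotent (↥(maximalRealSubfield L)) L (IsCMField.complexConj L) 3))
      [ν.IsHaarMeasure],
      ∃ (μB : Measure (borelAdelic (↥(maximalRealSubfield L)) L (IsCMField.complexConj L) 3))
        (_ : μB.IsHaarMeasure)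
        (S : Set (borelAdelic (↥(maximalRealSubfield L)) L (IsCMField.complexConj L) 3))
        (Ω : Set (quasiSplit (↥(maximalRealSubfield L)) L (IsCMField.complexConj L) 3).Adelic)
        (R₁ R₂ : Set (AdeleRing (𝓞 L) L)) (T₀ : ℝ≥0),
        IsClosed S ∧
        (∀ b ∈ S, ∀ k : borelAdelic (↥(maximalRealSubfield L)) L (IsCMField.complexConj L) 3,
          adelicVal (↥(maximalRealSubfield L)) L (IsCMField.complexConj L) 3 ((StdForm.antidiagonal 3).over L)
            (k : (quasiSplit (↥(maximalRealSubfield L)) L (IsCMField.complexConj L) 3).Adelic) ∈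
            standardMaximalCompactGL 3 L → b * k ∈ S) ∧
        (∀ g : (quasiSplit (↥(maximalRealSubfield L)) L (IsCMField.complexConj L) 3).Adelic,
          ∃ β : (quasiSplit (↥(maximalRealSubfield L)) L (IsCMField.complexConj L) 3).arithmeticSubgroup,
          β ∈ arithmeticBorel (↥(maximalRealSubfield L)) L (IsCMField.complexConj L) 3 ∧ ∃ b ∈ S,
          ∃ k : (quasiSplit (↥(maximalRealSubfield L)) L (IsCMField.complexConj L) 3).Adelic,
            adelicVal (↥(maximalRealSubfield L)) L (IsCMField.complexConj L) 3 ((StdForm.antidiagonal 3).over L) k ∈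
              standardMaximalCompactGL 3 L ∧
            (β : (quasiSplit (↥(maximalRealSubfield L)) L (IsCMField.complexConj L) 3).Adelic) * g =
              (b : (quasiSplit (↥(maximalRealSubfield L)) L (IsCMField.complexConj L) 3).Adelic) * k) ∧
        IsCompact Ω ∧ IsCompact R₁ ∧ IsCompact R₂ ∧
        (∀ b ∈ S, T₀ < borelHeight (b : (quasiSplit (↥(maximalRealSubfield L)) L (IsCMField.complexConj L) 3).Adelic) →
          (((torusPart b)⁻¹ * b : borelAdelic (↥(maximalRealSubfield L)) L (IsCMField.complexConj L) 3) :
              (quasiSplit (↥(maximalRealSubfield L)) L (IsCMField.complexConj L) 3).Adelic) ∈ Ω ∧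
          (((diagUnit b.2 0)⁻¹ * diagUnit b.2 1 : (AdeleRing (𝓞 L) L)ˣ) : AdeleRing (𝓞 L) L) ∈ R₁ ∧
          (((diagUnit b.2 0)⁻¹ * diagUnit b.2 2 : (AdeleRing (𝓞 L) L)ˣ) : AdeleRing (𝓞 L) L) ∈ R₂) ∧
        ∀ U ∈ finiteLevelsGL 3 L,
          ∃ (𝓕₀ W₀ : Set (adelicUnipotent (↥(maximalRealSubfield L)) L (IsCMField.complexConj L) 3))
            (ρ : borelAdelic (↥(maximalRealSubfield L)) L (IsCMField.complexConj L) 3 → ℝ),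
          IsFundamentalDomain (rationalUnipotent (↥(maximalRealSubfield L)) L (IsCMField.complexConj L) 3) 𝓕₀ ν ∧
          IsCompact W₀ ∧ 𝓕₀ ⊆ W₀ ∧
          (∀ b ∈ S, T₀ < borelHeight (b : (quasiSplit (↥(maximalRealSubfield L)) L (IsCMField.complexConj L) 3).Adelic) →
            ∀ k : (quasiSplit (↥(maximalRealSubfield L)) L (IsCMField.complexConj L) 3).Adelic,
            adelicVal (↥(maximalRealSubfield L)) L (IsCMField.complexConj L) 3 ((StdForm.antidiagonal 3).over L) k ∈
              standardMaximalCompactGL 3 L →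
            ∀ u ∈ 𝓕₀, ∃ (t₁ t₂ t₃ : ℝ) (X₁ X₂ X₃ : Matrix (Fin 3) (Fin 3) (mixedSpace L))
              (w : GL (Fin 3) (AdeleRing (𝓞 L) L)),
            X₁ ∈ S_dir ∧ X₂ ∈ S_dir ∧ X₃ ∈ S_dir ∧ w ∈ U ∧ |t₁| ≤ ρ b ∧ |t₂| ≤ ρ b ∧ |t₃| ≤ ρ b ∧
            adelicVal (↥(maximalRealSubfield L)) L (IsCMField.complexConj L) 3 _
                ((((b : (quasiSplit (↥(maximalRealSubfield L)) L (IsCMField.complexConj L) 3).Adelic) * k)⁻¹ *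
                  (u : (quasiSplit (↥(maximalRealSubfield L)) L (IsCMField.complexConj L) 3).Adelic) *
                  ((b : (quasiSplit (↥(maximalRealSubfield L)) L (IsCMField.complexConj L) 3).Adelic) * k))) =
              GLn.ofInfinite 3 L (expGL (t₁ • X₁) * expGL (t₂ • X₂) * expGL (t₃ • X₃)) * w) ∧
          (∀ T : ℝ≥0, T₀ < T →
            ∫⁻ b in S ∩ {b | T < borelHeight
                (b : (quasiSplit (↥(maximalRealSubfield L)) L (IsCMField.complexConj L) 3).Adelic)},
              ((torusRootModulus L 3 (diagUnit b.2) : ℝ≥0) : ℝ≥0∞) * ENNReal.ofReal (ρ b) ∂μB < ∞)) :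
    ∀ [MeasurableSpace (adelicUnipotent (↥(maximalRealSubfield L)) L (IsCMField.complexConj L) 3)]
      [BorelSpace (adelicUnipotent (↥(maximalRealSubfield L)) L (IsCMField.complexConj L) 3)]
      (ν : Measure (adelicUnipotent (↥(maximalRealSubfield L)) L (IsCMField.complexConj L) 3)) [ν.IsHaarMeasure]
      (𝓕 : Set (adelicUnipotent (↥(maximalRealSubfield L)) L (IsCMField.complexConj L) 3)),
      IsFundamentalDomain (rationalUnipotent (↥(maximalRealSubfield L)) L (IsCMField.complexConj L) 3) 𝓕 ν →
        ∀ (μ : Measure (quasiSplit (↥(maximalRealSubfield L)) L (IsCMField.complexConj L) 3).automorphicQuotient)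
          [(quasiSplit (↥(maximalRealSubfield L)) L (IsCMField.complexConj L) 3).IsAutomorphicMeasure μ]
          (f : (quasiSplit (↥(maximalRealSubfield L)) L (IsCMField.complexConj L) 3).Adelic → ℂ),
          IsQuasiSplitTest (↥(maximalRealSubfield L)) L (IsCMField.complexConj L) 3 f →
          ∀ i : ι, ∃ T₀ : ℝ≥0, ∀ T : ℝ≥0, T₀ < T →
            Integrable ((quasiSplit (↥(maximalRealSubfield L)) L (IsCMField.complexConj L) 3).quotFun
              (truncatedKernelClass ν 𝓕 T cl i f)) μ :=
  truncatedKernelClassIntegrable_of_rows (complexConj_mul_complexConj L) (IsCMField.complexConj_ne_one L)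
    (forall_isHaarMeasure_isMulRightInvariant_quasiSplit_cm_three L)
    (exists_mem_borelAdelic_mul_mem_standardMaximalCompactGL_cm_three L) hcl hclN hSdir hrows

end UnitaryGroup

end Literature.NumberTheory.Automorphic
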